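import Literature.RepresentationTheory.FiniteGroups.SymmetricGroupSquareEvaluation
import HarnessLib

/-!
# Det-side class sum for `λ = (13,13,2⁵)`, `(n, m) = (3, 3)`, `d = 12` — kernel chunks 106/117 (classes 10101–10309)

Cell `pub-gct` (bundle papers/PneNP/gct-obstructions). HONEST FRAMING of that cell: rung-1
multiplicity-obstruction search for permanent versus determinant at small `(n, m)`; no claim about
VP ≠ VNP or P ≠ NP is made here or there. This file is cell DATA: partial sums of the tree's verified
Murnaghan–Nakayama evaluator
`MNEval.skSumT 36 λᵗ (12, 12, 12)` (`λᵗ = (7,7,2¹¹)`; semantics `2·36!·sk(λ, 3×12) = skSumT 36 λᵗ (12³)`,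
`Literature/NumberTheory/DiophantineGeometry/DetOrbitSymKroneckerBoundEval.lean`, BLMW 2011 §5.2
(5.2.5)) over consecutive index ranges of the class list `MNEval.cycleTypes 36` of `𝔖_36`
(`p(36) = 17977` classes; this file: classes `10101, …, 10309` in 2 ranges), each range ONE
`decide +kernel` (standard axioms, no `native_decide`). The values were PREDICTED by the cell's
engine B (frozen `c36a7d1485af`, Murnaghan–Nakayama characters, the exact order of `cycleTypes` replicated)
and are here CHECKED by the kernel. The ranges of all chunk files are summed in
`DetSideSkTwelveThirteenThirteen.lean` (`skSumT 36 λᵗ (12³) = 0`, i.e. `sk(λ, 3×12) = 0`, the det-side number of this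
onset row of the cell's table — there a hypothesis of the tree's conditional certificate theorems,
after these files a kernel theorem). Packing note: files 1–91 (classes 0–8025, ≤ 150 classes per range) carry the
first packing's count "/108" in this header line; the remaining classes 8026–17976 were re-packed into files 92–117 with
few large ranges (the kernel re-walks `cycleTypes 36` up to the range start once per theorem, so fewer ranges are cheaper
in the character-zero tail). [folklore] bookkeeping; sources [BLMW2011] §5.2 Prop. 5.2.1,
[FultonHarrisGTM129] §2.1 / Ex. 4.51 (symmetric-square character formula), [BurgisserIkenmeyer2013] §5.
-/

namespace Summit.PneNP.GCT

open Literature.RepresentationTheory.FiniteGroups.MNEval (skTerm cycleTypes)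

namespace DetSideSkTwelveThirteenThirteen

/-- Kernel class sum of `skTerm 36 λᵗ (12³)` over classes `10101, …, 10189` of `cycleTypes 36`
(`89` classes; value predicted by engine B, checked by the kernel). [folklore] -/
theorem c_10101_89 :
    ((((cycleTypes 36).drop 10101).take 89).map (skTerm 36 [7, 7, 2, 2, 2, 2, 2, 2, 2, 2, 2, 2, 2] [12, 12, 12])).sum =
      -7046039082035859767211446205677568000000 := by
  set_option maxRecDepth 100000 in
  set_option maxHeartbeats 0 in decide +kernel

/-- Kernel class sum of `skTerm 36 λᵗ (12³)` over classes `10190, …, 10309` of `cycleTypes 36`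
(`120` classes; value predicted by engine B, checked by the kernel). [folklore] -/
theorem c_10190_120 :
    ((((cycleTypes 36).drop 10190).take 120).map (skTerm 36 [7, 7, 2, 2, 2, 2, 2, 2, 2, 2, 2, 2, 2] [12, 12, 12])).sum =
      4536375611017628181719637844977254400000 := by
  set_option maxRecDepth 100000 in
  set_option maxHeartbeats 0 in decide +kernel

end DetSideSkTwelveThirteenThirteen

end Summit.PneNP.GCT
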